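import Mathlib.LinearAlgebra.Dimension.StrongRankCondition
import Literature.NumberTheory.EllipticCurves.Iwasawa
import Literature.NumberTheory.EllipticCurves.ZpExtensionGlobalReciprocityProofs
import Literature.NumberTheory.GaloisRepresentations.IdelicCharacterProofs
import HarnessLib

/-!
# BSD family: the `ℤ_p`-rank of an imaginary quadratic field from the global reciprocity law (proofs)

Sibling proofs file of `Literature/NumberTheory/EllipticCurves/Iwasawa.lean` (**bsd.S22**).  It
derives the named fact

* `Literature.BSD.zpRank_imaginaryQuadratic K p` — an imaginary quadratic field has `ℤ_p`-extensions
  `κ₁, κ₂` with `(κ₁, κ₂) : Γ_K → ℤ_p²` surjective and every `ℤ_p`-extension `κ` inside their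
  compositum (`ker κ₁ ⊓ ker κ₂ ≤ ker κ`), i.e. `Gal(K̃/K) ≃ ℤ_p²` (Washington, *Introduction to
  Cyclotomic Fields*, Thm. 13.4 with `r₂ = 1`; Greenberg, LNM 1716 §1) —

from the single class-field-theoretic named fact `Literature.exists_isGlobalReciprocityMap K`
(`GaloisRepresentations/GlobalReciprocity.lean`: the Artin map `C_K → Γ_K^ab` is continuous and
surjective with kernel the infinitely divisible classes, plus the existence theorem; Neukirch,
*Class Field Theory — The Bonn Lectures*, III (7.12); Tate in Cassels–Fröhlich, Ch. VII §5).
This follows Washington's proof of Thm. 13.4 (§13.1, p. 265–266) on the idelic side: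

* *existence* (`rank ≥ 2`): two jointly surjective characters `κ₁, κ₂ : Γ_K →ₜ* ℤ_p`
  (`Literature.NumberTheory.EllipticCurves.ZpExtension.exists_pair_of_globalReciprocity`, `ZpExtensionGlobalReciprocityProofs.lean`);
* *injectivity* (`rank ≤ 2`): a continuous character `χ` of `Γ_K` factors through `Γ_K^ab`, hence
  pulls back along the Artin map to a continuous character `f` of `𝕀_K` trivial on `Kˣ`
  (`exists_idelicCharacter_of_character`); if `f` kills the local units `𝒪_vˣ`, `v ∣ p`, then
  `f = 1` (`Literature.NumberTheory.GaloisRepresentations.IdelicCharacter.eq_one_of_forall_localUnits`: unit ideles at `v ∤ p` and at `∞`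
  die in `ℤ_p`, and `x^h ∈ Kˣ 𝕌_K`), hence `χ = 1`; and `Hom_cont(𝒪_vˣ, ℤ_p)` has `ℤ_p`-rank
  `n_v` with `∑_{v∣p} n_v = [K:ℚ]` (`LocalOneUnitsNumberFieldProofs.lean`), so any
  `m > [K : ℚ]` continuous characters of `Γ_K` satisfy a non-trivial `ℤ_p`-linear relation
  (`exists_ne_zero_sum_mul_eq_zero`: Washington's
  "`rank_{ℤ_p} Gal(K̃/K) ≤ ∑_{𝔭∣p} [K_𝔭:ℚ_p] = [K:ℚ]`");
* for `[K : ℚ] = 2`: a relation `a₀ κ + a₁ κ₁ + a₂ κ₂ = 0` has `a₀ ≠ 0` by joint surjectivity of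
  `(κ₁, κ₂)`, whence `ker κ₁ ⊓ ker κ₂ ≤ ker κ` (`zpRank_imaginaryQuadratic_of_globalReciprocity`).

Compared with `IwasawaZpRankProofs.lean` (`zpRank_imaginaryQuadratic_of_classFieldTheory'`: the
fact from Washington Prop. 13.2 and Lang's `U_p/Ē ↪ Gal(M/K)`), the class-field-theoretic input
is here the global reciprocity law itself, shared with
`Literature.NumberTheory.EllipticCurves.ZpExtension.exists_isAnticyclotomic_of_kroneckerWeber_of_globalReciprocity`.

## References

* [Washington1997] L. C. Washington, *Introduction to Cyclotomic Fields*, 2nd ed., GTM 83,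
  Springer 1997, §13.1, Thm. 13.4 and its proof.
* [Neukirch2013] J. Neukirch, *Class Field Theory — The Bonn Lectures*, Springer 2013, III (7.12).
* [GreenbergLNM1716] R. Greenberg, *Iwasawa theory for elliptic curves*, LNM 1716 (1999), §1.
-/

noncomputable section

universe u

open NumberField IsDedekindDomain Field Topology

namespace Literature.NumberTheory.EllipticCurves.ZpExtension

variable {K : Type u} [Field K] [NumberField K] {p : ℕ} [Fact p.Prime]

/-! ### Pulling characters of `Γ_K` back to the ideles -/

/-- **A continuous character of `Γ_K` pulls back along the Artin map to a continuous character of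
`𝕀_K` trivial on `Kˣ`.**  `χ : Γ_K →ₜ* ℤ_p` kills the closed normal subgroup
`\overline{[Γ_K, Γ_K]}` (abelian Hausdorff target), so factors continuously through `Γ_K^ab`; with
`θ : C_K → Γ_K^ab` the reciprocity map, `f = χ^ab ∘ θ ∘ (𝕀_K → C_K)` is continuous, trivial on the
principal ideles, and `f x = χ σ` whenever `θ [x] = [σ]`.
Ref: Washington, *Introduction to Cyclotomic Fields*, §13.1, proof of Thm. 13.4. [folklore] -/
theorem exists_idelicCharacter_of_character
    {θ : GaloisRepresentations.ideleGroup K ⧸ GaloisRepresentations.principalIdeles K →* absoluteGaloisGroupAbelianization K}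
    (hθ : GaloisRepresentations.IsGlobalReciprocityMap K θ) (χ : absoluteGaloisGroup K →ₜ* Multiplicative ℤ_[p]) :
    ∃ f : GaloisRepresentations.ideleGroup K →ₜ* Multiplicative ℤ_[p],
      (∀ x ∈ GaloisRepresentations.principalIdeles K, f x = 1) ∧
      ∀ (x : GaloisRepresentations.ideleGroup K) (σ : absoluteGaloisGroup K),
        QuotientGroup.mk' (commutator (absoluteGaloisGroup K)).topologicalClosure σ =
          θ (x : GaloisRepresentations.ideleGroup K ⧸ GaloisRepresentations.principalIdeles K) → f x = χ σ := by
  -- `χ` factors through `Γ_K^ab`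
  have hle : (commutator (absoluteGaloisGroup K)).topologicalClosure ≤ χ.toMonoidHom.ker := by
    refine Subgroup.topologicalClosure_minimal _
      (Abelianization.commutator_subset_ker χ.toMonoidHom) ?_
    change IsClosed (χ ⁻¹' {1})
    exact (isClosed_singleton (x := (1 : Multiplicative ℤ_[p]))).preimage χ.continuous
  let χab : absoluteGaloisGroupAbelianization K →* Multiplicative ℤ_[p] :=
    QuotientGroup.lift _ χ.toMonoidHom hle
  have hχab : ∀ σ : absoluteGaloisGroup K,
      χab (QuotientGroup.mk' (commutator (absoluteGaloisGroup K)).topologicalClosure σ) = χ σ :=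
    fun σ => rfl
  have hχab_cont : Continuous χab :=
    (QuotientGroup.isQuotientMap_mk _).continuous_iff.2 χ.continuous
  let f : GaloisRepresentations.ideleGroup K →ₜ* Multiplicative ℤ_[p] :=
    ⟨χab.comp (θ.comp (QuotientGroup.mk' (GaloisRepresentations.principalIdeles K))),
      hχab_cont.comp (hθ.continuous.comp continuous_quot_mk)⟩
  have hf : ∀ x : GaloisRepresentations.ideleGroup K, f x = χab (θ (x : GaloisRepresentations.ideleGroup K ⧸ GaloisRepresentations.principalIdeles K)) := fun x => rfl
  refine ⟨f, fun x hx => ?_, fun x σ hσ => ?_⟩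
  · rw [hf, (QuotientGroup.eq_one_iff x).2 hx, map_one, map_one]
  · rw [hf, ← hσ, hχab]

/-- Conversely, the character `χ` is recovered from its idelic pull-back `f` (the Artin map and
`𝕀_K → C_K` are onto): if `f = 1` then `χ = 1`. [folklore] -/
theorem eq_one_of_idelicCharacter_eq_one
    {θ : GaloisRepresentations.ideleGroup K ⧸ GaloisRepresentations.principalIdeles K →* absoluteGaloisGroupAbelianization K}
    (hθ : GaloisRepresentations.IsGlobalReciprocityMap K θ) {χ : absoluteGaloisGroup K →ₜ* Multiplicative ℤ_[p]}
    {f : GaloisRepresentations.ideleGroup K →ₜ* Multiplicative ℤ_[p]}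
    (hf : ∀ (x : GaloisRepresentations.ideleGroup K) (σ : absoluteGaloisGroup K),
      QuotientGroup.mk' (commutator (absoluteGaloisGroup K)).topologicalClosure σ =
        θ (x : GaloisRepresentations.ideleGroup K ⧸ GaloisRepresentations.principalIdeles K) → f x = χ σ)
    (hf1 : f = 1) (σ : absoluteGaloisGroup K) : χ σ = 1 := by
  obtain ⟨c, hc⟩ := hθ.surjective
    (QuotientGroup.mk' (commutator (absoluteGaloisGroup K)).topologicalClosure σ)
  obtain ⟨x, rfl⟩ := QuotientGroup.mk_surjective c
  rw [← hf x σ hc.symm, hf1]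
  rfl

/-! ### The rank bound `rank_{ℤ_p} Hom_cont(Γ_K, ℤ_p) ≤ [K : ℚ]` -/

/-- **More than `[K : ℚ]` continuous `ℤ_p`-valued characters of `Γ_K` are `ℤ_p`-linearly
dependent** (granted the global reciprocity law).  Washington, *Introduction to Cyclotomic Fields*,
§13.1, proof of Thm. 13.4: `Hom(Gal(K̃/K), ℤ_p) ↪ Hom(∏_{𝔭∣p} U_𝔭, ℤ_p)` (here:
`exists_idelicCharacter_of_character` with `IdelicCharacter.eq_one_of_forall_localUnits`) and
`rank_{ℤ_p} U_𝔭 = [K_𝔭 : ℚ_p]`, `∑_{𝔭∣p} [K_𝔭:ℚ_p] = [K:ℚ]` (here: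
`OneUnits.exists_continuousMonoidHom_adicCompletionIntegers_rank`, `OneUnits.sum_eq_finrank`).
Concretely: the `p^{N_v}`-multiples of the restrictions to `𝒪_vˣ` are `ℤ_p`-combinations of
`n_v` fixed characters; the `m × [K:ℚ]` coefficient matrix has a non-zero left kernel vector `a`,
and `∑ aⱼ ψⱼ` pulls back to an idelic character killing all `𝒪_vˣ`, `v ∣ p`, hence vanishes.
[folklore] -/
theorem exists_ne_zero_sum_mul_eq_zero (hGR : GaloisRepresentations.exists_isGlobalReciprocityMap K) {m : ℕ}
    (hm : Module.finrank ℚ K < m) (ψ : Fin m → (absoluteGaloisGroup K →ₜ* Multiplicative ℤ_[p])) :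
    ∃ a : Fin m → ℤ_[p], a ≠ 0 ∧
      ∀ σ : absoluteGaloisGroup K, ∑ j, a j * (ψ j σ).toAdd = 0 := by
  classical
  obtain ⟨θ, hθ⟩ := hGR
  have hp : p.Prime := Fact.out
  -- idelic pull-backs of the `ψ j`
  have hf : ∀ j, ∃ f : GaloisRepresentations.ideleGroup K →ₜ* Multiplicative ℤ_[p],
      (∀ x ∈ GaloisRepresentations.principalIdeles K, f x = 1) ∧
      ∀ (x : GaloisRepresentations.ideleGroup K) (σ : absoluteGaloisGroup K),
        QuotientGroup.mk' (commutator (absoluteGaloisGroup K)).topologicalClosure σ =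
          θ (x : GaloisRepresentations.ideleGroup K ⧸ GaloisRepresentations.principalIdeles K) → f x = ψ j σ := fun j =>
    exists_idelicCharacter_of_character hθ (ψ j)
  choose f hfprinc hfcomp using hf
  -- the places above `p`
  have hfin : {w : HeightOneSpectrum (𝓞 K) | (p : 𝓞 K) ∈ w.asIdeal}.Finite := by
    have hp0 : (Ideal.span {(p : 𝓞 K)} : Ideal (𝓞 K)) ≠ 0 := by
      rw [Ne, Ideal.zero_eq_bot, Ideal.span_singleton_eq_bot]
      exact_mod_cast hp.ne_zero
    refine (Ideal.finite_factors hp0).subset fun w hw => ?_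
    change w.asIdeal ∣ Ideal.span {(p : 𝓞 K)}
    rw [Ideal.dvd_span_singleton]
    exact hw
  let T : Finset (HeightOneSpectrum (𝓞 K)) := hfin.toFinset
  have hT : ∀ w : HeightOneSpectrum (𝓞 K), (p : 𝓞 K) ∈ w.asIdeal ↔ w ∈ T := fun w => by
    rw [Set.Finite.mem_toFinset]
    rfl
  -- local generators of the character groups of the `𝒪_wˣ`
  have hloc : ∀ w : HeightOneSpectrum (𝓞 K), ∃ (n N : ℕ)
      (φ : Fin n → ((w.adicCompletionIntegers K)ˣ →ₜ* Multiplicative ℤ_[p])),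
      ((p : 𝓞 K) ∈ w.asIdeal →
        Nat.card (w.adicCompletionIntegers K ⧸ Ideal.span {(p : w.adicCompletionIntegers K)}) = p ^ n ∧
        ∀ ψ' : (w.adicCompletionIntegers K)ˣ →ₜ* Multiplicative ℤ_[p], ∃ c : Fin n → ℤ_[p],
          ∀ u : (w.adicCompletionIntegers K)ˣ,
            (p : ℤ_[p]) ^ N * (ψ' u).toAdd = ∑ i, c i * (φ i u).toAdd) := by
    intro w
    by_cases hw : (p : 𝓞 K) ∈ w.asIdeal
    · obtain ⟨n, N, φ, hcard, -, hspan⟩ :=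
        GaloisRepresentations.OneUnits.exists_continuousMonoidHom_adicCompletionIntegers_rank K w p hw
      exact ⟨n, N, φ, fun _ => ⟨hcard, hspan⟩⟩
    · exact ⟨0, 0, Fin.elim0, fun h => absurd h hw⟩
  choose n N φ hnφ using hloc
  have hsum : ∑ w ∈ T, n w = Module.finrank ℚ K :=
    GaloisRepresentations.OneUnits.sum_eq_finrank K p T (fun w hw => (hT w).1 hw) n fun w hw => (hnφ w ((hT w).2 hw)).1
  -- restrictions of the `f j` to the local units at `w ∈ T`, and their coordinates
  let res : Fin m → ∀ w : HeightOneSpectrum (𝓞 K),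
      ((w.adicCompletionIntegers K)ˣ →ₜ* Multiplicative ℤ_[p]) := fun j w =>
    ⟨(f j).toMonoidHom.comp ((GaloisRepresentations.localUnits w).comp (Units.map ((w.adicCompletionIntegers K).subtype :
        w.adicCompletionIntegers K →* w.adicCompletion K))),
      (f j).continuous.comp (GaloisRepresentations.IdelicCharacter.continuous_localUnits_unitsMap w)⟩
  have hres : ∀ j w (u : (w.adicCompletionIntegers K)ˣ), res j w u =
      f j (GaloisRepresentations.localUnits w (Units.map ((w.adicCompletionIntegers K).subtype : _ →* _) u)) :=
    fun j w u => rfl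
  have hcoord : ∀ (j : Fin m) (w : HeightOneSpectrum (𝓞 K)), w ∈ T → ∃ c : Fin (n w) → ℤ_[p],
      ∀ u : (w.adicCompletionIntegers K)ˣ,
        (p : ℤ_[p]) ^ N w * (res j w u).toAdd = ∑ i, c i * (φ w i u).toAdd := fun j w hw =>
    (hnφ w ((hT w).2 hw)).2 (res j w)
  choose c hc using hcoord
  -- the coefficient vectors are linearly dependent: `m > ∑ n_w = [K:ℚ]`
  let V : Fin m → ((Σ w : T, Fin (n w)) → ℤ_[p]) := fun j wi => c j wi.1 wi.1.2 wi.2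
  have hdep : ¬ LinearIndependent ℤ_[p] V := by
    intro hli
    have h1 := hli.fintype_card_le_finrank
    rw [Module.finrank_fintype_fun_eq_card, Fintype.card_fin, Fintype.card_sigma] at h1
    simp only [Fintype.card_fin] at h1
    rw [Finset.sum_coe_sort T n, hsum] at h1
    omega
  obtain ⟨a, ha, j₀, hj₀⟩ := Fintype.not_linearIndependent_iff.1 hdep
  have haV : ∀ (w : HeightOneSpectrum (𝓞 K)) (hw : w ∈ T) (i : Fin (n w)),
      ∑ j, a j * c j w hw i = 0 := fun w hw i => by
    have := congrFun ha ⟨⟨w, hw⟩, i⟩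
    simpa [V, Finset.sum_apply, Pi.smul_apply, smul_eq_mul] using this
  -- the idelic character `∑ aⱼ fⱼ`
  let G : GaloisRepresentations.ideleGroup K →ₜ* Multiplicative ℤ_[p] :=
    { toFun := fun x => Multiplicative.ofAdd (∑ j, a j * (f j x).toAdd)
      map_one' := by simp
      map_mul' := fun x y => by
        rw [← ofAdd_add, ← Finset.sum_add_distrib]
        congr 1
        refine Finset.sum_congr rfl fun j _ => ?_
        rw [map_mul, toAdd_mul, mul_add]
      continuous_toFun := continuous_ofAdd.comp (continuous_finsetSum _ fun j _ =>
        continuous_const.mul (continuous_toAdd.comp (f j).continuous)) }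
  have hG : ∀ x, (G x).toAdd = ∑ j, a j * (f j x).toAdd := fun x => rfl
  have hGprinc : ∀ x ∈ GaloisRepresentations.principalIdeles K, G x = 1 := fun x hx => by
    apply Multiplicative.toAdd.injective
    rw [hG, toAdd_one]
    exact Finset.sum_eq_zero fun j _ => by rw [hfprinc j x hx, toAdd_one, mul_zero]
  have hGloc : ∀ w : HeightOneSpectrum (𝓞 K), (p : 𝓞 K) ∈ w.asIdeal →
      ∀ u : (w.adicCompletionIntegers K)ˣ,
        G (GaloisRepresentations.localUnits w (Units.map ((w.adicCompletionIntegers K).subtype : _ →* _) u)) = 1 := by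
    intro w hw u
    have hwT : w ∈ T := (hT w).1 hw
    apply Multiplicative.toAdd.injective
    rw [hG, toAdd_one]
    -- multiply by `p^{N_w}`
    have hpN : (p : ℤ_[p]) ^ N w ≠ 0 := pow_ne_zero _ (by exact_mod_cast hp.ne_zero)
    refine (mul_eq_zero.1 ?_).resolve_left hpN
    rw [Finset.mul_sum]
    calc ∑ j, (p : ℤ_[p]) ^ N w * (a j * (f j (GaloisRepresentations.localUnits w (Units.map
            ((w.adicCompletionIntegers K).subtype : _ →* _) u))).toAdd)
        = ∑ j, a j * ∑ i, c j w hwT i * (φ w i u).toAdd := by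
          refine Finset.sum_congr rfl fun j _ => ?_
          rw [← hres, mul_left_comm, hc j w hwT u]
      _ = ∑ i, (∑ j, a j * c j w hwT i) * (φ w i u).toAdd := by
          simp_rw [Finset.mul_sum, Finset.sum_mul, mul_assoc]
          rw [Finset.sum_comm]
      _ = 0 := Finset.sum_eq_zero fun i _ => by rw [haV w hwT i, zero_mul]
  have hG1 : G = 1 := GaloisRepresentations.IdelicCharacter.eq_one_of_forall_localUnits (p := p) G hGprinc hGloc
  refine ⟨a, fun h => hj₀ (by rw [h]; rfl), fun σ => ?_⟩
  obtain ⟨cσ, hcσ⟩ := hθ.surjective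
    (QuotientGroup.mk' (commutator (absoluteGaloisGroup K)).topologicalClosure σ)
  obtain ⟨x, rfl⟩ := QuotientGroup.mk_surjective cσ
  have h := congrArg Multiplicative.toAdd (DFunLike.congr_fun hG1 x)
  rw [hG] at h
  change ∑ j, a j * (f j x).toAdd = 0 at h
  rw [← h]
  exact Finset.sum_congr rfl fun j _ => by rw [hfcomp j x σ hcσ.symm]

end Literature.NumberTheory.EllipticCurves.ZpExtension

namespace Literature.NumberTheory.EllipticCurves

open ZpExtension

variable {K : Type u} [Field K] [NumberField K] {p : ℕ} [Fact p.Prime]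

variable (K p) in
/-- **bsd.S22 — `zpRank_imaginaryQuadratic` from the global reciprocity law.**  An imaginary
quadratic field `K` has `ℤ_p`-rank exactly `2`: there are `ℤ_p`-extensions `κ₁, κ₂` with
`(κ₁, κ₂) : Γ_K → ℤ_p × ℤ_p` surjective, and every `ℤ_p`-extension `κ` of `K` satisfies
`ker κ₁ ⊓ ker κ₂ ≤ ker κ` (`Gal(K̃/K) ≃ ℤ_p²`; Washington, *Introduction to Cyclotomic Fields*,
Thm. 13.4 with `r₂ = 1` and Leopoldt trivial; Greenberg, LNM 1716 §1), granted the global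
reciprocity law `Literature.exists_isGlobalReciprocityMap K` (Neukirch, Bonn Lectures III (7.12)).
Existence: `exists_pair_of_globalReciprocity`.  Upper bound: by `exists_ne_zero_sum_mul_eq_zero`
the three characters `κ, κ₁, κ₂` satisfy `a₀κ + a₁κ₁ + a₂κ₂ = 0` with `a ≠ 0`; joint
surjectivity of `(κ₁, κ₂)` forces `a₀ ≠ 0`, so `κ` vanishes on `ker κ₁ ⊓ ker κ₂` (`ℤ_p` is a
domain). [cite: Washington1997, Thm. 13.4] [cite: GreenbergLNM1716, §1] -/
theorem zpRank_imaginaryQuadratic_of_globalReciprocity (hGR : GaloisRepresentations.exists_isGlobalReciprocityMap K) :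
    zpRank_imaginaryQuadratic K p := by
  classical
  intro hK himag
  have h0 : NumberField.Units.rank K = 0 := units_rank_eq_zero_of_finrank_eq_two hK himag
  obtain ⟨κ₁, κ₂, hsurj⟩ := exists_pair_of_globalReciprocity (p := p) hK h0 hGR
  have hsurj₁ : Function.Surjective κ₁ := fun y => by
    obtain ⟨σ, hσ⟩ := hsurj (y.toAdd, 0)
    exact ⟨σ, Multiplicative.toAdd.injective (congrArg Prod.fst hσ)⟩
  have hsurj₂ : Function.Surjective κ₂ := fun y => by
    obtain ⟨σ, hσ⟩ := hsurj (0, y.toAdd)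
    exact ⟨σ, Multiplicative.toAdd.injective (congrArg Prod.snd hσ)⟩
  refine ⟨⟨κ₁, hsurj₁⟩, ⟨κ₂, hsurj₂⟩, ?_, ?_⟩
  · rintro ⟨y₁, y₂⟩
    obtain ⟨σ, hσ⟩ := hsurj (y₁.toAdd, y₂.toAdd)
    refine ⟨σ, Prod.ext ?_ ?_⟩
    · exact Multiplicative.toAdd.injective (congrArg Prod.fst hσ)
    · exact Multiplicative.toAdd.injective (congrArg Prod.snd hσ)
  · intro κ σ hσ
    rw [Subgroup.mem_inf, mem_kerSubgroup, mem_kerSubgroup] at hσ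
    -- a non-trivial relation among `κ, κ₁, κ₂`
    let ψ : Fin 3 → (absoluteGaloisGroup K →ₜ* Multiplicative ℤ_[p]) :=
      ![κ.toContinuousMonoidHom, κ₁, κ₂]
    obtain ⟨a, ha, hrel⟩ := exists_ne_zero_sum_mul_eq_zero (p := p) hGR (m := 3)
      (by rw [hK]; norm_num) ψ
    have hrel' : ∀ τ : absoluteGaloisGroup K,
        a 0 * (κ τ).toAdd + a 1 * (κ₁ τ).toAdd + a 2 * (κ₂ τ).toAdd = 0 := fun τ => by
      have h := hrel τ
      simp only [Fin.sum_univ_three, ψ, Matrix.cons_val_zero, Matrix.cons_val_one,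
        Matrix.cons_val_two, Matrix.head_cons, Matrix.tail_cons] at h
      exact h
    -- `a 0 ≠ 0` by joint surjectivity of `(κ₁, κ₂)`
    have ha0 : a 0 ≠ 0 := by
      intro ha0
      obtain ⟨τ₁, hτ₁⟩ := hsurj (1, 0)
      obtain ⟨τ₂, hτ₂⟩ := hsurj (0, 1)
      have h1 := hrel' τ₁
      have h2 := hrel' τ₂
      simp only [Prod.mk.injEq] at hτ₁ hτ₂
      rw [ha0, zero_mul, zero_add, hτ₁.1, hτ₁.2, mul_one, mul_zero, add_zero] at h1
      rw [ha0, zero_mul, zero_add, hτ₂.1, hτ₂.2, mul_one, mul_zero, zero_add] at h2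
      apply ha
      funext i
      fin_cases i
      · simpa using ha0
      · simpa using h1
      · simpa using h2
    -- conclude on `ker κ₁ ⊓ ker κ₂`
    have h := hrel' σ
    rw [show (κ₁ σ).toAdd = 0 from (congrArg Multiplicative.toAdd hσ.1).trans toAdd_one,
      show (κ₂ σ).toAdd = 0 from (congrArg Multiplicative.toAdd hσ.2).trans toAdd_one,
      mul_zero, mul_zero, add_zero, add_zero] at h
    rw [mem_kerSubgroup]
    apply Multiplicative.toAdd.injective
    rw [toAdd_one]
    exact (mul_eq_zero.1 h).resolve_left ha0

end Literature.NumberTheory.EllipticCurves
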